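import Literature.NumberTheory.LFunctions.DobnerSelbergClassSteepest
import Literature.NumberTheory.LFunctions.DobnerSelbergClassConvexityProofs
import Mathlib.Analysis.SpecialFunctions.Gaussian.GaussianIntegral
import HarnessLib

/-!
# Dobner's series representation `ξ^F_t(J_t(s)) = ∑ aₙ B_{t,n}(s)` for `F ∈ 𝒮♯` (proofs)

RH-FREE literature PROOFS (no definitions, no named facts). Trunk T-ANT
(`Literature/NumberTheory/LFunctions`); node N1-a of the plan of record for the discharge of
`Literature.NumberTheory.LFunctions.dobner_theorem2` (HOME/drafts/rt/t7-N1-PLAN.md §2; rt-lead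
ruling (15), rt/STATUS 2026-08-26). Companion of `DobnerSelbergClassSteepest.lean` (the objects
`J_t = ExtendedSelbergDatum.dobnerJ`, the integrand `𝓘 = ExtendedSelbergDatum.dobnerI`,
`B_{t,n} = ExtendedSelbergDatum.dobnerB`) and of `DobnerSelbergClassConvexityProofs.lean` (Dobner's
eq. (3.1) on the line `Re w = 2`, `ExtendedSelbergDatum.xiDeformed_eq_integral_xi_two`); the
`F = ζ` case is the tree theorem
`Literature.NumberTheory.LFunctions.xiDeformed_dobnerJ_eq_tsum_dobnerB` (`DobnerSteepestDescent.lean`),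
whose proof is ported here line by line.

> A. Dobner, *A proof of Newman's conjecture for the extended Selberg class*, Acta Arith. 201
> (2021) = arXiv:2005.05142 (held; page numbers of the 18-page arXiv text), **§4, p. 10, first
> display**: "We are interested in estimating `ξ^F_t(J_t(s))`, so by (3.1) we know
> `ξ^F_t(J_t(s)) = (1/(i√(π|t|))) ∫_{2−i∞}^{2+i∞} ξ^F(z) e^{(J_t(s)−z)²/|t|} dz` for all `t < 0`. By
> inserting the definition `ξ^F(z) = γ(z) ∑ aₙ n^{−z}` and then interchanging the sum and integral
> (which can be justified since the contour is in the half-plane of absolute convergence of the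
> Dirichlet series `F`) we get `ξ^F_t(J_t(s)) = ∑_{n=1}^{∞} aₙ B_{t,n}(s)` where
> `B_{t,n}(s) := (1/(i√(π|t|))) ∫_{2−i∞}^{2+i∞} γ(z) e^{(J_t(s)−z)²/|t|} n^{−z} dz`" (eq. (4.1)).

## Contents (all proved; `D : ExtendedSelbergDatum`, `k = D.numGamma ≥ 1` where needed)

* `ExtendedSelbergDatum.differentiableAt_gamma_of_re_pos`, `continuous_gamma_vertical`,
  `norm_gamma_vertical_le`, `exists_norm_gamma_two_le` — `γ` is holomorphic on `Re z > 0`,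
  continuous on vertical lines there, polynomially bounded on every line `Re z = σ > 0`
  (`‖γ(σ+iv)‖ ≤ ‖α‖ Q^σ ∏Γ(ωᵢσ + Re μᵢ) (σ+1+|v|)^{2m}`, from `|Γ(w)| ≤ Γ(Re w)`; this lemma and
  its proof are taken verbatim from seat rt-t6 g3's banked draft HOME/drafts/rt/t6-N1a-BANKED.lean,
  for the large-`n` file L4a to import), and BOUNDED on the line
  `Re z = 2` when `k ≥ 1` (Dobner's Lemma 1 = the tree theorem
  `Literature.NumberTheory.LFunctions.dobner_lemma1_holds` for `|Im z| ≥ T₀`, compactness below);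
* `ExtendedSelbergDatum.continuous_dobnerI_vertical`, `norm_coeff_mul_dobnerI_two`,
  `integrable_coeff_mul_dobnerI_two`, `integrable_dobnerI_two`,
  `summable_integral_norm_coeff_mul_dobnerI_two` — the justification of the interchange: on
  `z = 2 + iv`, `‖aₙ 𝓘(z)‖ = (‖aₙ‖/n²) ‖γ(z)‖ e^{((Re J−2)² − (Im J−v)²)/|t|}` is dominated by
  `(‖aₙ‖ n⁻²) · M e^{(Re J−2)²/|t|} e^{−(v − Im J)²/|t|}`, summable in `n` by (i) at `s = 2`
  (`ExtendedSelbergDatum.summable`) and integrable in `v` (Gaussian);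
* `ExtendedSelbergDatum.xi_two_mul_gaussian_eq_tsum` — pointwise on the line:
  `ξ^F(2+iv) e^{(J−2−iv)²/|t|} = ∑ₙ aₙ 𝓘ₙ(2+iv)` ((i): `F = ∑ aₙ n^{−z}` on `Re z > 1`,
  `ExtendedSelbergDatum.eqOn_LSeries`);
* **`ExtendedSelbergDatum.xiDeformed_dobnerJ_eq_tsum`** — the display
  `ξ^F_t(J_t(s)) = ∑ₙ aₙ B_{t,n}(s)` for every datum with `k ≥ 1`, every `t < 0` and EVERY
  `s ∈ ℂ` (the `n = 0` term of the `tsum` vanishes, `ExtendedSelbergDatum.dobnerB_zero`);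
* `ExtendedSelbergDatum.summable_norm_coeff_mul_dobnerB` — `∑ₙ ‖aₙ B_{t,n}(s)‖ < ∞`.

`J_t` is this tree's exact-cancellation variant (`DobnerSelbergClassSteepest.lean`, module
docstring "DEVIATION FROM PRINT", admitted by rt-lead ruling (15)(c)); the series representation
holds verbatim for it since (3.1) holds for every `w` and is applied at `w = J_t(s)`.

bears_on: N-C/N-P (COLUMN 3 DBN). WHAT THIS IS NOT: nothing here bears on the truth of RH; `Λ_ζ ≥ 0`
is already the kernel theorem `Literature.NumberTheory.LFunctions.rodgers_tao_holds`, and this file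
is real/complex analysis about `𝒮♯` in support of the `𝒮♯`-generalisation (Dobner's Thm. 2).
-/

noncomputable section

open Complex Filter Set MeasureTheory

namespace Literature.NumberTheory.LFunctions

namespace ExtendedSelbergDatum

variable (D : ExtendedSelbergDatum)

/-! ### `γ` on vertical lines in the right half-plane -/

/-- `γ` is holomorphic on the right half-plane `Re z > 0` ("the `Γ` function has no poles in the
right half-plane", p. 5; the polar factor `sᵐ(s−1)ᵐ` and `Qˢ` are entire).
[cite: Dobner2021, §2 p. 5] -/
theorem differentiableAt_gamma_of_re_pos {z : ℂ} (hz : 0 < z.re) :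
    DifferentiableAt ℂ D.gamma z := by
  have e : D.gamma = fun s ↦ (D.alpha * s ^ D.polarOrder * (D.Q : ℂ) ^ s *
      ∏ i, Complex.Gamma ((D.omega i : ℂ) * s + D.mu i)) * (s - 1) ^ D.polarOrder :=
    funext D.gamma_eq_core_mul
  rw [e]
  exact (D.differentiableAt_core hz).mul ((differentiableAt_id.sub_const _).pow _)

/-- `γ` is continuous along every vertical line `Re z = σ > 0`. [cite: Dobner2021, §2 p. 5] -/
theorem continuous_gamma_vertical {σ : ℝ} (hσ : 0 < σ) :
    Continuous fun v : ℝ ↦ D.gamma (σ + v * I) := by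
  have hline : Continuous fun v : ℝ ↦ ((σ : ℂ) + v * I) := by fun_prop
  refine continuous_iff_continuousAt.2 fun v ↦ ?_
  have hd := D.differentiableAt_gamma_of_re_pos (z := (σ : ℂ) + v * I) (by simp [hσ])
  exact ContinuousAt.comp' (f := fun v : ℝ ↦ ((σ : ℂ) + v * I)) hd.continuousAt hline.continuousAt

/-- `γ` is continuous along the line `Re z = 2`. [cite: Dobner2021, §4 eq. (4.1), p. 10] -/
theorem continuous_gamma_two : Continuous fun v : ℝ ↦ D.gamma (2 + v * I) := by
  have h := D.continuous_gamma_vertical (σ := 2) two_pos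
  simpa using h

/-- **Polynomial bound for `γ` on a vertical line `Re z = σ > 0`**:
`‖γ(σ + iv)‖ ≤ ‖α‖ Q^σ (∏ᵢ Γ(ωᵢ σ + Re μᵢ)) (σ + 1 + |v|)^{2m}` (no pole of `γ` has positive real
part; `|Γ(w)| ≤ Γ(Re w)` for `Re w > 0`). [cite: Dobner2021, §2 (iii) p. 5 and §4 p. 10] -/
theorem norm_gamma_vertical_le {σ : ℝ} (hσ : 0 < σ) (v : ℝ) :
    ‖D.gamma (σ + v * I)‖ ≤ ‖D.alpha‖ * D.Q ^ σ * (∏ i, Real.Gamma (D.omega i * σ + (D.mu i).re)) *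
      (σ + 1 + |v|) ^ (2 * D.polarOrder) := by
  set w : ℂ := σ + v * I with hw
  have hwre : w.re = σ := by simp [hw]
  have hnw' : ‖w‖ ≤ σ + |v| := by
    calc ‖w‖ ≤ ‖(σ : ℂ)‖ + ‖(v : ℂ) * I‖ := norm_add_le _ _
      _ = |σ| + |v| := by rw [norm_mul, Complex.norm_I, mul_one, Complex.norm_real, Complex.norm_real,
            Real.norm_eq_abs, Real.norm_eq_abs]
      _ = σ + |v| := by rw [abs_of_pos hσ]
  have hnw : ‖w‖ ≤ σ + 1 + |v| := by linarith
  have hnw1 : ‖w - 1‖ ≤ σ + 1 + |v| := by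
    linarith [norm_sub_le w (1 : ℂ), norm_one (α := ℂ)]
  have hΓ : ∀ i, ‖Complex.Gamma ((D.omega i : ℂ) * w + D.mu i)‖ ≤
      Real.Gamma (D.omega i * σ + (D.mu i).re) := by
    intro i
    have hre : ((D.omega i : ℂ) * w + D.mu i).re = D.omega i * σ + (D.mu i).re := by
      simp [hw]
    have hpos : 0 < ((D.omega i : ℂ) * w + D.mu i).re := by
      rw [hre]
      have := mul_pos (D.omega_pos i) hσ
      linarith [D.mu_re_nonneg i]
    have := norm_Gamma_le_Gamma_re hpos
    rwa [hre] at this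
  have hprod : ∏ i, ‖Complex.Gamma ((D.omega i : ℂ) * w + D.mu i)‖ ≤
      ∏ i, Real.Gamma (D.omega i * σ + (D.mu i).re) :=
    Finset.prod_le_prod (fun i _ ↦ norm_nonneg _) fun i _ ↦ hΓ i
  have hQ : ‖(D.Q : ℂ) ^ w‖ = D.Q ^ σ := by
    rw [Complex.norm_cpow_eq_rpow_re_of_pos D.Q_pos, hwre]
  have h0 : 0 ≤ σ + 1 + |v| := by positivity
  have hQpos : 0 < D.Q := D.Q_pos
  have hQσ : 0 < D.Q ^ σ := Real.rpow_pos_of_pos hQpos σ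
  rw [gamma, dobnerGamma_apply, norm_mul, norm_mul, norm_mul, norm_mul, norm_pow, norm_pow, hQ,
    norm_prod]
  have hprod0 : 0 ≤ ∏ i, ‖Complex.Gamma ((D.omega i : ℂ) * w + D.mu i)‖ :=
    Finset.prod_nonneg fun i _ ↦ norm_nonneg _
  calc ‖D.alpha‖ * ‖w‖ ^ D.polarOrder * ‖w - 1‖ ^ D.polarOrder * D.Q ^ σ *
        ∏ i, ‖Complex.Gamma ((D.omega i : ℂ) * w + D.mu i)‖
      ≤ ‖D.alpha‖ * (σ + 1 + |v|) ^ D.polarOrder * (σ + 1 + |v|) ^ D.polarOrder * D.Q ^ σ *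
        ∏ i, Real.Gamma (D.omega i * σ + (D.mu i).re) := by
        gcongr
    _ = _ := by rw [two_mul, pow_add]; ring

/-- **`γ` is bounded on the line `Re z = 2`** (`k ≥ 1`): `‖γ(2 + iv)‖ ≤ M` for all real `v`.
For `|v| ≥ T₀` this is Dobner's Lemma 1 (`|γ(z)| ≤ e^{−K|Im z|} ≤ 1` for `|Re z| ≤ 2`,
`Literature.NumberTheory.LFunctions.dobner_lemma1_holds` with `D = 2`, `θ = 0`); on the compact
segment `|v| ≤ T₀` by continuity. [cite: Dobner2021, Lemma 1, p. 5] -/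
theorem exists_norm_gamma_two_le (hk : 0 < D.numGamma) :
    ∃ M : ℝ, 0 < M ∧ ∀ v : ℝ, ‖D.gamma (2 + v * I)‖ ≤ M := by
  obtain ⟨K, K', T₀, hK, -, hγ⟩ := dobner_lemma1_holds D.alpha D.polarOrder D.Q D.numGamma D.omega
    D.mu D.alpha_ne_zero D.Q_pos hk D.omega_pos D.mu_re_nonneg 2 0 two_pos le_rfl one_pos
  set T : ℝ := max T₀ 0 with hT
  obtain ⟨M₁, hM₁⟩ := (isCompact_Icc (a := -T) (b := T)).exists_bound_of_continuousOn
    D.continuous_gamma_two.continuousOn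
  refine ⟨max 1 M₁, lt_max_of_lt_left one_pos, fun v ↦ ?_⟩
  have hre : ((2 : ℂ) + v * I).re = 2 := by simp
  have him : ((2 : ℂ) + v * I).im = v := by simp
  rcases le_or_gt T |v| with hlarge | hsmall
  · have h1 : |((2 : ℂ) + v * I).re| ≤ 2 * |((2 : ℂ) + v * I).im| ^ (0 : ℝ) := by
      rw [hre, Real.rpow_zero, mul_one, abs_two]
    have h2 : T₀ ≤ |((2 : ℂ) + v * I).im| := by
      rw [him]; exact (le_max_left _ _).trans hlarge
    have h := (hγ (2 + v * I) h1 h2).2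
    rw [him] at h
    calc ‖D.gamma (2 + v * I)‖ ≤ Real.exp (-(K * |v|)) := h
      _ ≤ 1 := by
          rw [Real.exp_le_one_iff]
          have : 0 ≤ K * |v| := by positivity
          linarith
      _ ≤ max 1 M₁ := le_max_left _ _
  · have hmem : v ∈ Icc (-T) T := ⟨by linarith [neg_abs_le v], by linarith [le_abs_self v]⟩
    exact (hM₁ v hmem).trans (le_max_right _ _)

/-! ### The summands `aₙ 𝓘ₙ(2 + iv)`: continuity, size, domination -/

/-- The integrand `𝓘` is continuous along every vertical line `Re z = σ > 0` (for every `n`; for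
`n = 0` it vanishes identically). [cite: Dobner2021, Lemma 6 (definition of 𝓘), p. 11] -/
theorem continuous_dobnerI_vertical (t : ℝ) (n : ℕ) (s : ℂ) {σ : ℝ} (hσ : 0 < σ) :
    Continuous fun v : ℝ ↦ D.dobnerI t n s (σ + v * I) := by
  unfold dobnerI
  have hγ := D.continuous_gamma_vertical hσ
  have hcpow : Continuous fun v : ℝ ↦ (n : ℂ) ^ (-((σ : ℂ) + v * I)) := by
    rcases Nat.eq_zero_or_pos n with rfl | hn
    · have : (fun v : ℝ ↦ ((0 : ℕ) : ℂ) ^ (-((σ : ℂ) + v * I))) = fun _ ↦ 0 := by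
        funext v
        rw [Nat.cast_zero, Complex.zero_cpow]
        intro h
        have := congrArg Complex.re h
        simp at this
        linarith
      rw [this]
      exact continuous_const
    · exact continuous_const.cpow (by fun_prop) fun v ↦ Or.inl (by exact_mod_cast hn)
  fun_prop

/-- `𝓘` is continuous along the line `Re z = 2`. [cite: Dobner2021, §4 eq. (4.1), p. 10] -/
theorem continuous_dobnerI_two (t : ℝ) (n : ℕ) (s : ℂ) :
    Continuous fun v : ℝ ↦ D.dobnerI t n s (2 + v * I) := by
  have h := D.continuous_dobnerI_vertical t n s (σ := 2) two_pos
  simpa using h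

/-- **Size of the `n`-th summand on the line `Re z = 2`**:
`‖aₙ 𝓘ₙ(2+iv)‖ = ‖aₙ n⁻²‖ · ‖γ(2+iv)‖ e^{((Re J_t(s) − 2)² − (Im J_t(s) − v)²)/|t|}` (the first
factor is the norm of the `n`-th term of the Dirichlet series of `F` at `2`; both sides vanish for
`n = 0`). [cite: Dobner2021, §4 p. 10 (interchange of sum and integral)] -/
theorem norm_coeff_mul_dobnerI_two (t : ℝ) (n : ℕ) (s : ℂ) (v : ℝ) :
    ‖D.coeff n * D.dobnerI t n s (2 + v * I)‖ = ‖LSeries.term D.coeff 2 n‖ *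
      (‖D.gamma (2 + v * I)‖ *
        Real.exp ((((D.dobnerJ t s).re - 2) ^ 2 - ((D.dobnerJ t s).im - v) ^ 2) / |t|)) := by
  rcases Nat.eq_zero_or_pos n with rfl | hn
  · have hz : -((2 : ℂ) + v * I) ≠ 0 := by
      intro h
      have := congrArg Complex.re h
      simp at this
    simp only [dobnerI, Nat.cast_zero, Complex.zero_cpow hz, mul_zero, zero_mul, norm_zero,
      LSeries.term_zero]
  · rw [norm_mul, D.norm_dobnerI t hn, LSeries.norm_term_eq, if_neg hn.ne']
    have hre : ((2 : ℂ) + v * I).re = 2 := by simp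
    have him : ((2 : ℂ) + v * I).im = v := by simp
    have h2 : (2 : ℂ).re = 2 := by simp
    rw [hre, him, h2, Real.rpow_neg (Nat.cast_nonneg n), div_eq_mul_inv]
    ring

/-- **Domination of the summands** (`k ≥ 1`, `t ≠ 0`): there is an integrable `G ≥ 0` with
`‖aₙ 𝓘ₙ(2+iv)‖ ≤ ‖aₙ n⁻²‖ G(v)` for all `n, v`, namely
`G(v) = M e^{(Re J−2)²/|t|} e^{−(v − Im J)²/|t|}` with `M` the bound of `γ` on `Re z = 2`
("interchanging the sum and integral … can be justified since the contour is in the half-plane of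
absolute convergence", p. 10). [cite: Dobner2021, §4 p. 10] -/
theorem exists_norm_coeff_mul_dobnerI_two_le (hk : 0 < D.numGamma) {t : ℝ} (ht : t ≠ 0) (s : ℂ) :
    ∃ G : ℝ → ℝ, Integrable G ∧ (∀ v, 0 ≤ G v) ∧
      ∀ (n : ℕ) (v : ℝ), ‖D.coeff n * D.dobnerI t n s (2 + v * I)‖ ≤ ‖LSeries.term D.coeff 2 n‖ * G v := by
  have ht' : 0 < |t| := abs_pos.2 ht
  obtain ⟨M, hM, hγM⟩ := D.exists_norm_gamma_two_le hk
  set J : ℂ := D.dobnerJ t s with hJ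
  refine ⟨fun v ↦ M * Real.exp ((J.re - 2) ^ 2 / |t|) * Real.exp (-(1 / |t|) * (v - J.im) ^ 2),
    ?_, fun v ↦ by positivity, fun n v ↦ ?_⟩
  · exact ((integrable_exp_neg_mul_sq (b := 1 / |t|) (by positivity)).comp_sub_right J.im).const_mul _
  · rw [D.norm_coeff_mul_dobnerI_two]
    refine mul_le_mul_of_nonneg_left ?_ (norm_nonneg _)
    have hexp : Real.exp (((J.re - 2) ^ 2 - (J.im - v) ^ 2) / |t|) =
        Real.exp ((J.re - 2) ^ 2 / |t|) * Real.exp (-(1 / |t|) * (v - J.im) ^ 2) := by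
      rw [← Real.exp_add]
      congr 1
      field_simp
      ring
    rw [hexp]
    calc ‖D.gamma (2 + v * I)‖ * (Real.exp ((J.re - 2) ^ 2 / |t|) *
          Real.exp (-(1 / |t|) * (v - J.im) ^ 2))
        ≤ M * (Real.exp ((J.re - 2) ^ 2 / |t|) * Real.exp (-(1 / |t|) * (v - J.im) ^ 2)) := by
          gcongr; exact hγM v
      _ = M * Real.exp ((J.re - 2) ^ 2 / |t|) * Real.exp (-(1 / |t|) * (v - J.im) ^ 2) := by ring

/-- Each summand `v ↦ aₙ 𝓘ₙ(2+iv)` is integrable over the line (`k ≥ 1`, `t ≠ 0`).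
[cite: Dobner2021, §4 p. 10] -/
theorem integrable_coeff_mul_dobnerI_two (hk : 0 < D.numGamma) {t : ℝ} (ht : t ≠ 0) (n : ℕ)
    (s : ℂ) : Integrable fun v : ℝ ↦ D.coeff n * D.dobnerI t n s (2 + v * I) := by
  obtain ⟨G, hGi, -, hG⟩ := D.exists_norm_coeff_mul_dobnerI_two_le hk ht s
  exact (hGi.const_mul _).mono' (continuous_const.mul (D.continuous_dobnerI_two t n s)).aestronglyMeasurable
    (Eventually.of_forall (hG n))

/-- The integrand `v ↦ 𝓘ₙ(2+iv)` of `B_{t,n}(s)` is integrable over the line (`k ≥ 1`, `t ≠ 0`;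
for `n = 0` it vanishes), so that (4.1) is a genuine Bochner integral.
[cite: Dobner2021, §4 eq. (4.1), p. 10] -/
theorem integrable_dobnerI_two (hk : 0 < D.numGamma) {t : ℝ} (ht : t ≠ 0) (n : ℕ) (s : ℂ) :
    Integrable fun v : ℝ ↦ D.dobnerI t n s (2 + v * I) := by
  rcases Nat.eq_zero_or_pos n with rfl | hn
  · have : (fun v : ℝ ↦ D.dobnerI t 0 s (2 + v * I)) = fun _ ↦ 0 := by
      funext v
      have hz : -((2 : ℂ) + v * I) ≠ 0 := by
        intro h
        have := congrArg Complex.re h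
        simp at this
      simp only [dobnerI, Nat.cast_zero, Complex.zero_cpow hz, mul_zero, zero_mul]
    rw [this]
    exact integrable_zero _ _ _
  · obtain ⟨M, hM, hγM⟩ := D.exists_norm_gamma_two_le hk
    have ht' : 0 < |t| := abs_pos.2 ht
    set J : ℂ := D.dobnerJ t s with hJ
    have hdom : ∀ v : ℝ, ‖D.dobnerI t n s (2 + v * I)‖ ≤
        M * Real.exp ((J.re - 2) ^ 2 / |t|) * Real.exp (-(1 / |t|) * (v - J.im) ^ 2) := by
      intro v
      rw [D.norm_dobnerI t hn]
      have hre : ((2 : ℂ) + v * I).re = 2 := by simp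
      have him : ((2 : ℂ) + v * I).im = v := by simp
      rw [hre, him]
      have hn1 : (n : ℝ) ^ (-(2 : ℝ)) ≤ 1 :=
        Real.rpow_le_one_of_one_le_of_nonpos (by exact_mod_cast hn) (by norm_num)
      have hexp : Real.exp (((J.re - 2) ^ 2 - (J.im - v) ^ 2) / |t|) =
          Real.exp ((J.re - 2) ^ 2 / |t|) * Real.exp (-(1 / |t|) * (v - J.im) ^ 2) := by
        rw [← Real.exp_add]
        congr 1
        field_simp
        ring
      rw [hexp]
      calc ‖D.gamma (2 + v * I)‖ * (n : ℝ) ^ (-(2 : ℝ)) *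
            (Real.exp ((J.re - 2) ^ 2 / |t|) * Real.exp (-(1 / |t|) * (v - J.im) ^ 2))
          ≤ M * 1 * (Real.exp ((J.re - 2) ^ 2 / |t|) * Real.exp (-(1 / |t|) * (v - J.im) ^ 2)) := by
            gcongr
            exact hγM v
        _ = M * Real.exp ((J.re - 2) ^ 2 / |t|) * Real.exp (-(1 / |t|) * (v - J.im) ^ 2) := by ring
    have hGi' : Integrable fun v : ℝ ↦
        M * Real.exp ((J.re - 2) ^ 2 / |t|) * Real.exp (-(1 / |t|) * (v - J.im) ^ 2) :=
      ((integrable_exp_neg_mul_sq (b := 1 / |t|) (by positivity)).comp_sub_right J.im).const_mul _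
    exact hGi'.mono' (D.continuous_dobnerI_two t n s).aestronglyMeasurable (Eventually.of_forall hdom)

/-- **Summability of the integrated norms** `∑ₙ ∫ ‖aₙ 𝓘ₙ(2+iv)‖ dv < ∞` (`k ≥ 1`, `t ≠ 0`): by
the domination `‖aₙ 𝓘ₙ‖ ≤ ‖aₙ n⁻²‖ G` and the absolute convergence of `∑ aₙ n⁻²` (condition (i)
at `s = 2`). This is the hypothesis of `MeasureTheory.integral_tsum_of_summable_integral_norm`.
[cite: Dobner2021, §4 p. 10] -/
theorem summable_integral_norm_coeff_mul_dobnerI_two (hk : 0 < D.numGamma) {t : ℝ} (ht : t ≠ 0)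
    (s : ℂ) : Summable fun n : ℕ ↦ ∫ v : ℝ, ‖D.coeff n * D.dobnerI t n s (2 + v * I)‖ := by
  obtain ⟨G, hGi, -, hG⟩ := D.exists_norm_coeff_mul_dobnerI_two_le hk ht s
  have hs2 : Summable fun n : ℕ ↦ ‖LSeries.term D.coeff 2 n‖ :=
    (D.summable 2 (by simp)).norm
  refine Summable.of_nonneg_of_le (fun n ↦ integral_nonneg fun v ↦ norm_nonneg _) (fun n ↦ ?_)
    (hs2.mul_right (∫ v, G v))
  calc ∫ v : ℝ, ‖D.coeff n * D.dobnerI t n s (2 + v * I)‖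
      ≤ ∫ v : ℝ, ‖LSeries.term D.coeff 2 n‖ * G v :=
        integral_mono (D.integrable_coeff_mul_dobnerI_two hk ht n s).norm (hGi.const_mul _) (hG n)
    _ = ‖LSeries.term D.coeff 2 n‖ * ∫ v : ℝ, G v := integral_const_mul _ _

/-! ### The series representation -/

/-- **Pointwise expansion on the line `Re z = 2`**: for `z = 2 + iv`,
`ξ^F(z) e^{(J_t(s) − z)²/|t|} = ∑ₙ aₙ 𝓘ₙ(z)` — insert `ξ^F(z) = γ(z) F(z)` and the absolutely
convergent Dirichlet series `F(z) = ∑ aₙ n^{−z}` of condition (i) (`Re z = 2 > 1`).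
[cite: Dobner2021, §4 p. 10] -/
theorem xi_two_mul_gaussian_eq_tsum (t : ℝ) (s : ℂ) (v : ℝ) :
    D.xi (2 + v * I) * Complex.exp (((1 / |t| : ℝ) : ℂ) * (D.dobnerJ t s - (2 + v * I)) ^ 2) =
      ∑' n : ℕ, D.coeff n * D.dobnerI t n s (2 + v * I) := by
  have hre : 1 < ((2 : ℂ) + v * I).re := by simp
  have hF2 : D.toFun (2 + v * I) = LSeries D.coeff (2 + v * I) := D.eqOn_LSeries hre
  rw [xi_apply, hF2, LSeries, mul_assoc,
    mul_comm (∑' n : ℕ, LSeries.term D.coeff (2 + v * I) n) _, ← mul_assoc, ← tsum_mul_left]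
  refine tsum_congr fun n ↦ ?_
  rcases Nat.eq_zero_or_pos n with rfl | hn
  · have hz : -((2 : ℂ) + v * I) ≠ 0 := by
      intro h
      have := congrArg Complex.re h
      simp at this
    rw [LSeries.term_zero, mul_zero, dobnerI, Nat.cast_zero, Complex.zero_cpow hz, mul_zero,
      zero_mul, mul_zero]
  · rw [LSeries.term_of_ne_zero hn.ne', dobnerI, Complex.cpow_neg]
    ring

/-- **Dobner's series representation for the extended Selberg class** (§4, p. 10, first display):
for every datum `F ∈ 𝒮♯` with `k ≥ 1`, every `t < 0` and every `s ∈ ℂ`,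
`ξ^F_t(J_t(s)) = ∑ₙ aₙ B_{t,n}(s)`, where `B_{t,n}(s) = (π|t|)^{−1/2} ∫_ℝ 𝓘ₙ(2+iv) dv` is the
integral (4.1) on the line `Re z = 2`. Proof as printed: eq. (3.1) at `w = J_t(s)`
(`xiDeformed_eq_integral_xi_two`), the pointwise expansion `xi_two_mul_gaussian_eq_tsum`, and the
interchange of sum and integral (`MeasureTheory.integral_tsum_of_summable_integral_norm`, justified
by `summable_integral_norm_coeff_mul_dobnerI_two`). The `n = 0` term of the `tsum` is `0`.
[cite: Dobner2021, §4 p. 10 (display before eq. (4.1))] -/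
theorem xiDeformed_dobnerJ_eq_tsum (hk : 0 < D.numGamma) {t : ℝ} (ht : t < 0) (s : ℂ) :
    D.xiDeformed t (D.dobnerJ t s) = ∑' n : ℕ, D.coeff n * D.dobnerB t n s := by
  have ht0 : t ≠ 0 := ht.ne
  have hFint := D.integrable_coeff_mul_dobnerI_two hk ht0 (s := s)
  have hFsum := D.summable_integral_norm_coeff_mul_dobnerI_two hk ht0 s
  rw [D.xiDeformed_eq_integral_xi_two hk ht (D.dobnerJ t s)]
  have hpt : ∀ v : ℝ, D.xi (2 + v * I) *
      Complex.exp (((1 / |t| : ℝ) : ℂ) * (D.dobnerJ t s - (2 + v * I)) ^ 2) =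
        ∑' n : ℕ, D.coeff n * D.dobnerI t n s (2 + v * I) := D.xi_two_mul_gaussian_eq_tsum t s
  simp_rw [hpt]
  rw [← integral_tsum_of_summable_integral_norm (fun n ↦ hFint n) hFsum, ← tsum_mul_left]
  refine tsum_congr fun n ↦ ?_
  rw [dobnerB, integral_const_mul]
  ring

/-- **Absolute convergence of `∑ₙ aₙ B_{t,n}(s)`** (`k ≥ 1`, `t ≠ 0`):
`∑ₙ ‖aₙ B_{t,n}(s)‖ ≤ (π|t|)^{−1/2} ∑ₙ ∫ ‖aₙ 𝓘ₙ(2+iv)‖ dv < ∞`. [cite: Dobner2021, §4 p. 10] -/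
theorem summable_norm_coeff_mul_dobnerB (hk : 0 < D.numGamma) {t : ℝ} (ht : t ≠ 0) (s : ℂ) :
    Summable fun n : ℕ ↦ ‖D.coeff n * D.dobnerB t n s‖ := by
  have hFsum := D.summable_integral_norm_coeff_mul_dobnerI_two hk ht s
  set c : ℝ := 1 / Real.sqrt (Real.pi * |t|) with hc
  refine Summable.of_nonneg_of_le (fun n ↦ norm_nonneg _) (fun n ↦ ?_) (hFsum.mul_left ‖(c : ℂ)‖)
  have e : D.coeff n * D.dobnerB t n s =
      (c : ℂ) * ∫ v : ℝ, D.coeff n * D.dobnerI t n s (2 + v * I) := by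
    rw [dobnerB, integral_const_mul]
    ring
  rw [e, norm_mul]
  exact mul_le_mul_of_nonneg_left (norm_integral_le_integral_norm _) (norm_nonneg _)

/-- The series `∑ₙ aₙ B_{t,n}(s)` converges (absolutely). [cite: Dobner2021, §4 p. 10] -/
theorem summable_coeff_mul_dobnerB (hk : 0 < D.numGamma) {t : ℝ} (ht : t ≠ 0) (s : ℂ) :
    Summable fun n : ℕ ↦ D.coeff n * D.dobnerB t n s :=
  (D.summable_norm_coeff_mul_dobnerB hk ht s).of_norm

end ExtendedSelbergDatum

end Literature.NumberTheory.LFunctions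

end
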